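import Summits.QuantumFields.BalabanUV.T4Continuum.Support.NE7SmoothRightInverseLevelQ
import Summits.QuantumFields.BalabanUV.T4Continuum.Support.NE7EffectiveFormLandauSliceGap
import Summits.QuantumFields.BalabanUV.T4Continuum.Support.NE7MinActHessianFlatCurl
import HarnessLib

/-!
# NE7EffectiveFormUpperBound — THE UNIFORM UPPER BOUND OF BAŁABAN'S VARIATIONAL QUADRATIC FORM AT THE FLAT BACKGROUND:
# `⟨v, Δ_{j+1} v⟩ = D²(minAct_{j+1} ∘ chart_1)(0)[v,v] ≤ 16·(24·8³)²·Σ_{x ∈ [0,N)^4} Σ_κ ‖ṽ(x)_κ‖²_{HS∕n}` — `‖Δ_{j+1}‖ ≤ 2 415 919 104`, EVERY LEVEL `j`, EVERY VOLUME `N`, EVERY `U(n)`, EVERY `L ≥ 2`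

Lineage `b2b-balaban-t4-ne7b-p1` (row NE7b OWNER; junction service for row NE7), generation 160; item (U) of the road's memo `t4/b2b-balaban-t4-ne7-p1-g116/ROAD-G116.md` §6
(«uniform UPPER bound `‖Δ_{j+1}‖ ≤ C` via a right inverse of `levelQ′`; the blockwise-constant lift costs `L^{j+1}`»).  THE MECHANISM: ✓ `NE7MinActHessianFlatCurl.minAct_hessian_flat_curl`
(the Hessian is the LEAST element of `{w^{j+1}·Σ_p nhsNormSq (curl_1 X̃ p) : levelQ' j 1 X = v}`, `w = 1` at `d = 4`) evaluated at ROW NE3's EXACT SMOOTH RIGHT INVERSE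
✓ `NE3SmoothRightInverseFlat.smoothRightInverse L j ṽ` (a `levelQ'`-preimage of `v`: ✓ `NE7SmoothRightInverseLevelQ.levelQ'_flatCfg_smoothRightInverse`), whose curl letter is
✓ `NE7SmoothRightInverseLevelQ.sum_nhsNormSq_curl_smoothRightInverse_le` (`≤ 4d·(24·8^{d−1})²·M^{d−4}·Σ nhsNormSq ṽ`, `M^{d−4} = 1` at `d = 4`).
WHAT ([folklore]; 0 def, 0 sorry; `d = 4`, every `U(n)`, `L ≥ 2`, `0 < ε ≤ ε₀`, `N ≥ 1`, EVERY `j`, every `v ∈ skewSub 4 n N`, `ṽ = chartDir id N v`):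
* **`effectiveForm_le_mass_flat_allLevels`**: `D²(minAct 4 (sfClass 4 L N ε) L N (j+1) ∘ chart_1)(0)[v,v] ≤ 16·(24·8³)²·Σ_{x ∈ periodBox N} Σ_κ nhsNormSq (ṽ x κ)` — THE OPERATOR-NORM BOUND
  `‖Δ^{flat}_{j+1}‖ ≤ 2 415 919 104` in the `nhsNormSq` mass, UNIFORM in the level, the volume, the colour number and `L`;
  `effectiveForm_le_opNormSq_flat_allLevels`: the same against `Σ_x Σ_κ ‖ṽ x κ‖²` (operator norm; `nhsNormSq ≤ ‖·‖²`).
* **`effectiveForm_two_sided_flat_allLevels`**: `Σ_P nhsNormSq (curl_1 ṽ P) ≤ D²m_{j+1}(0)[v,v] ≤ 16·(24·8³)²·Σ_x Σ_κ nhsNormSq (ṽ x κ)` (with the road's sharp lower bound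
  ✓ `effectiveForm_ge_coarse_curl_flat_allLevels'`), one `ε₀` for both;
  **`effectiveForm_spectral_window_landau_meanZero`**: on (Landau slice) ∩ (constants)^⊥ the Rayleigh quotient of `Δ^{flat}_{j+1}` in the `nhsNormSq` mass lies in
  `[2∕(N(N−1)), 16·(24·8³)²]` (✓ `NE7EffectiveFormLandauSliceGap.effectiveForm_landau_meanZero_gap_flat_allLevels` for the floor) — every `j`, `n`; the `N` of the floor is the
  torus Poincaré constant.
HONEST FRAMING: flat datum; a quadratic-form bound for OUR variational `Δ_{j+1}` (B11 (8) minimisers with `sfClass`); the constant is row NE3's lift constant, not optimised;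
nothing of Bałaban's asserted ([Balaban1984PropagatorsI] (1.20)–(1.21) context only); NOT NE7 as a spine node; row NE7b NOT touched; spine 0∕9; finite T⁴ rung (B)+1 — NOT
infinite volume, NOT mass gap, NOT BetaPertH, NOT Clay.
-/

set_option autoImplicit false

open scoped BigOperators Matrix Matrix.Norms.L2Operator Topology
open NormedSpace Finset

namespace Summit.QuantumFields.BalabanUV.T4Continuum.NE7EffectiveFormUpperBound

open Literature.MathematicalPhysics.QuantumFieldTheory.Balaban1983to89
open B7Prop1Explicit B7Prop2Explicit
open T4AveragingDeficitWall (curl curlAt)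
open T4AveragingDeficitWallBoundary (periodBox)
open AveragingDeficitTorusChart (TDir chart chartDir)
open AveragingDeficitTwoLevelPrep (skewSub)
open AveragingDeficitMultiLevelPrep (tower levelQ' tower_ne_zero)
open MinimalActionLevels (perWin stepWt)
open MinimalActionSandwich (minAct)
open MinimalActionRate (sfClass)
open MinimalActionWitness (flatCfg)
open MatrixNorms (nhsNormSq nhsNormSq_nonneg nhsNormSq_le_opNorm_sq)
open NE3SmoothRightInverseFlat (smoothRightInverse)
open NE7MinActHessianFlatCurl (minAct_hessian_flat_curl)
open NE7EffectiveFormCoarseCurlAllLevels (stepWt_four tower_window effectiveForm_ge_coarse_curl_flat_allLevels')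
open NE7EffectiveFormLandauSliceGap (effectiveForm_landau_meanZero_gap_flat_allLevels)
open NE7SmoothRightInverseLevelQ (levelQ'_flatCfg_smoothRightInverse resDir_smoothRightInverse_mem chartDir_resDir_smoothRightInverse
  sum_nhsNormSq_curl_smoothRightInverse_le)

noncomputable section

variable {n : Type} [Fintype n] [DecidableEq n]

/-- **THE UNIFORM UPPER BOUND** (`d = 4`, every `U(n)`, `L ≥ 2`): for `0 < ε ≤ ε₀`, `N ≥ 1`, EVERY `j`, every `v ∈ skewSub 4 n N`,
`D²(minAct 4 (sfClass 4 L N ε) L N (j+1) ∘ chart_1)(0)[v, v] ≤ 16·(24·8³)²·Σ_{x ∈ periodBox N} Σ_κ nhsNormSq (ṽ x κ)` — `‖Δ^{flat}_{j+1}‖ ≤ 2 415 919 104`, uniformly in `j`, `N`, `n`, `L`. [folklore] -/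
theorem effectiveForm_le_mass_flat_allLevels [Nonempty n] {L : ℕ} [NeZero L] (hL : 2 ≤ L) :
    ∃ ε₀ : ℝ, 0 < ε₀ ∧ ∀ ε : ℝ, 0 < ε → ε ≤ ε₀ → ∀ (N : ℕ) [NeZero N], 1 ≤ N → ∀ (j : ℕ) (v : ↥(skewSub 4 n N)),
      fderiv ℝ (fderiv ℝ (fun y : ↥(skewSub 4 n N) => minAct 4 (sfClass 4 L N ε) L N (j + 1)
          (chart (ContinuousLinearMap.id ℝ (Matrix n n ℂ)) N (flatCfg : Site 4 → Fin 4 → (Matrix n n ℂ)ˣ) (y : TDir 4 n N)))) 0 v v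
        ≤ 16 * (24 * (8 : ℝ) ^ 3) ^ 2 * ∑ x ∈ periodBox N, ∑ κ : Fin 4, nhsNormSq (chartDir (ContinuousLinearMap.id ℝ (Matrix n n ℂ)) N (v : TDir 4 n N) x κ) := by
  obtain ⟨ε₀, hε₀, H⟩ := minAct_hessian_flat_curl (n := n) hL
  refine ⟨ε₀, hε₀, fun ε hε hεle N _ hN j v => ?_⟩
  obtain ⟨-, hleast⟩ := H ε hε hεle N hN j
  haveI : NeZero (L * tower L N j) := ⟨Nat.mul_ne_zero (NeZero.ne L) (tower_ne_zero L N j)⟩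
  set φ := chartDir (ContinuousLinearMap.id ℝ (Matrix n n ℂ)) N (v : TDir 4 n N) with hφ
  set X : ↥(skewSub 4 n (L * tower L N j)) := ⟨AveragingDeficitTorusChart.resDir (L * tower L N j) (smoothRightInverse L j φ), resDir_smoothRightInverse_mem j v⟩ with hX
  have hXv : levelQ' L N j (flatCfg : Site 4 → Fin 4 → (Matrix n n ℂ)ˣ) (X : TDir 4 n (L * tower L N j)) = v := levelQ'_flatCfg_smoothRightInverse hL j v
  -- the Hessian is below the value of the curl energy at the preimage `X`
  have hle := (hleast v).2 ⟨X, hXv, rfl⟩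
  have hchart : chartDir (ContinuousLinearMap.id ℝ (Matrix n n ℂ)) (L * tower L N j) (X : TDir 4 n (L * tower L N j)) = smoothRightInverse L j φ :=
    chartDir_resDir_smoothRightInverse j v
  rw [hchart, stepWt_four, inv_one, one_pow, one_mul] at hle
  refine hle.trans ?_
  -- the curl letter of the smooth right inverse, `M^4 ∕ M^4 = 1`
  have hletter := sum_nhsNormSq_curl_smoothRightInverse_le (d := 4) (n := n) hL (by norm_num) j N φ
  rw [show L ^ (j + 1) * N = N * L ^ (j + 1) from Nat.mul_comm _ _] at hletter
  have hM0 : (((L ^ (j + 1) : ℕ) : ℝ)) ≠ 0 := by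
    have hL0 : L ≠ 0 := NeZero.ne L
    exact_mod_cast pow_ne_zero _ hL0
  rw [div_self (pow_ne_zero _ hM0), mul_one] at hletter
  refine hletter.trans (le_of_eq ?_)
  norm_num

/-- **THE UPPER BOUND AGAINST THE OPERATOR-NORM MASS**: `D²m_{j+1}(0)[v,v] ≤ 16·(24·8³)²·Σ_{x ∈ periodBox N} Σ_κ ‖ṽ x κ‖²` (`nhsNormSq ≤ ‖·‖²`). [folklore] -/
theorem effectiveForm_le_opNormSq_flat_allLevels [Nonempty n] {L : ℕ} [NeZero L] (hL : 2 ≤ L) :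
    ∃ ε₀ : ℝ, 0 < ε₀ ∧ ∀ ε : ℝ, 0 < ε → ε ≤ ε₀ → ∀ (N : ℕ) [NeZero N], 1 ≤ N → ∀ (j : ℕ) (v : ↥(skewSub 4 n N)),
      fderiv ℝ (fderiv ℝ (fun y : ↥(skewSub 4 n N) => minAct 4 (sfClass 4 L N ε) L N (j + 1)
          (chart (ContinuousLinearMap.id ℝ (Matrix n n ℂ)) N (flatCfg : Site 4 → Fin 4 → (Matrix n n ℂ)ˣ) (y : TDir 4 n N)))) 0 v v
        ≤ 16 * (24 * (8 : ℝ) ^ 3) ^ 2 * ∑ x ∈ periodBox N, ∑ κ : Fin 4, ‖chartDir (ContinuousLinearMap.id ℝ (Matrix n n ℂ)) N (v : TDir 4 n N) x κ‖ ^ 2 := by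
  obtain ⟨ε₀, hε₀, H⟩ := effectiveForm_le_mass_flat_allLevels (n := n) hL
  refine ⟨ε₀, hε₀, fun ε hε hεle N _ hN j v => (H ε hε hεle N hN j v).trans ?_⟩
  exact mul_le_mul_of_nonneg_left (Finset.sum_le_sum fun x _ => Finset.sum_le_sum fun κ _ => nhsNormSq_le_opNorm_sq _) (by positivity)

/-- **THE TWO-SIDED ESTIMATE AT THE FLAT BACKGROUND, EVERY LEVEL**: `Σ_{P ∈ perWin N} nhsNormSq (curl_1 ṽ P) ≤ D²m_{j+1}(0)[v,v] ≤ 16·(24·8³)²·Σ_{x ∈ periodBox N} Σ_κ nhsNormSq (ṽ x κ)`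
(the floor is the road's sharp coarse-Maxwell bound ✓ `effectiveForm_ge_coarse_curl_flat_allLevels'`), uniformly in `j`, `N`, `n`. [folklore] -/
theorem effectiveForm_two_sided_flat_allLevels [Nonempty n] {L : ℕ} [NeZero L] (hL : 2 ≤ L) :
    ∃ ε₀ : ℝ, 0 < ε₀ ∧ ∀ ε : ℝ, 0 < ε → ε ≤ ε₀ → ∀ (N : ℕ) [NeZero N], 1 ≤ N → ∀ (j : ℕ) (v : ↥(skewSub 4 n N)),
      ∑ P ∈ perWin 4 N, nhsNormSq (curl (flatCfg : Site 4 → Fin 4 → (Matrix n n ℂ)ˣ) (chartDir (ContinuousLinearMap.id ℝ (Matrix n n ℂ)) N (v : TDir 4 n N)) P)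
          ≤ fderiv ℝ (fderiv ℝ (fun y : ↥(skewSub 4 n N) => minAct 4 (sfClass 4 L N ε) L N (j + 1)
              (chart (ContinuousLinearMap.id ℝ (Matrix n n ℂ)) N (flatCfg : Site 4 → Fin 4 → (Matrix n n ℂ)ˣ) (y : TDir 4 n N)))) 0 v v ∧
      fderiv ℝ (fderiv ℝ (fun y : ↥(skewSub 4 n N) => minAct 4 (sfClass 4 L N ε) L N (j + 1)
          (chart (ContinuousLinearMap.id ℝ (Matrix n n ℂ)) N (flatCfg : Site 4 → Fin 4 → (Matrix n n ℂ)ˣ) (y : TDir 4 n N)))) 0 v v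
        ≤ 16 * (24 * (8 : ℝ) ^ 3) ^ 2 * ∑ x ∈ periodBox N, ∑ κ : Fin 4, nhsNormSq (chartDir (ContinuousLinearMap.id ℝ (Matrix n n ℂ)) N (v : TDir 4 n N) x κ) := by
  obtain ⟨ε₁, hε₁, H₁⟩ := effectiveForm_ge_coarse_curl_flat_allLevels' (n := n) hL
  obtain ⟨ε₂, hε₂, H₂⟩ := effectiveForm_le_mass_flat_allLevels (n := n) hL
  refine ⟨min ε₁ ε₂, lt_min hε₁ hε₂, fun ε hε hεle N _ hN j v => ⟨?_, ?_⟩⟩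
  · exact H₁ ε hε (hεle.trans (min_le_left _ _)) N hN j v
  · exact H₂ ε hε (hεle.trans (min_le_right _ _)) N hN j v

/-- **THE SPECTRAL WINDOW ON (LANDAU SLICE) ∩ (CONSTANTS)^⊥**: for `ṽ` coarse-Landau (`Σ_μ (ṽ(x)_μ − ṽ(x−e_μ)_μ) = 0`) with `Σ_{z ∈ periodBox N} ṽ(z)_ν = 0` for every `ν`,
`(2∕(N(N−1)))`-floor and `16·(24·8³)²`-ceiling: `Σ_x Σ_ν nhsNormSq (ṽ x ν) ≤ (N(N−1)∕2)·D²m_{j+1}(0)[v,v]` and `D²m_{j+1}(0)[v,v] ≤ 16·(24·8³)²·Σ_x Σ_ν nhsNormSq (ṽ x ν)`,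
every `j`, `n` (one `ε₀`). [folklore] -/
theorem effectiveForm_spectral_window_landau_meanZero [Nonempty n] {L : ℕ} [NeZero L] (hL : 2 ≤ L) :
    ∃ ε₀ : ℝ, 0 < ε₀ ∧ ∀ ε : ℝ, 0 < ε → ε ≤ ε₀ → ∀ (N : ℕ) [NeZero N], 1 ≤ N → ∀ (j : ℕ) (v : ↥(skewSub 4 n N)),
      (∀ x : Site 4, ∑ μ : Fin 4,
          (chartDir (ContinuousLinearMap.id ℝ (Matrix n n ℂ)) N (v : TDir 4 n N) x μ
            - chartDir (ContinuousLinearMap.id ℝ (Matrix n n ℂ)) N (v : TDir 4 n N) (x - e μ) μ) = 0) →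
      (∀ ν : Fin 4, ∑ z ∈ periodBox N, chartDir (ContinuousLinearMap.id ℝ (Matrix n n ℂ)) N (v : TDir 4 n N) z ν = 0) →
      ∑ x ∈ periodBox N, ∑ ν : Fin 4, nhsNormSq (chartDir (ContinuousLinearMap.id ℝ (Matrix n n ℂ)) N (v : TDir 4 n N) x ν)
          ≤ (N : ℝ) * ((N : ℝ) - 1) / 2 *
            fderiv ℝ (fderiv ℝ (fun y : ↥(skewSub 4 n N) => minAct 4 (sfClass 4 L N ε) L N (j + 1)
              (chart (ContinuousLinearMap.id ℝ (Matrix n n ℂ)) N (flatCfg : Site 4 → Fin 4 → (Matrix n n ℂ)ˣ) (y : TDir 4 n N)))) 0 v v ∧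
      fderiv ℝ (fderiv ℝ (fun y : ↥(skewSub 4 n N) => minAct 4 (sfClass 4 L N ε) L N (j + 1)
          (chart (ContinuousLinearMap.id ℝ (Matrix n n ℂ)) N (flatCfg : Site 4 → Fin 4 → (Matrix n n ℂ)ˣ) (y : TDir 4 n N)))) 0 v v
        ≤ 16 * (24 * (8 : ℝ) ^ 3) ^ 2 * ∑ x ∈ periodBox N, ∑ κ : Fin 4, nhsNormSq (chartDir (ContinuousLinearMap.id ℝ (Matrix n n ℂ)) N (v : TDir 4 n N) x κ) := by
  obtain ⟨ε₁, hε₁, H₁⟩ := effectiveForm_landau_meanZero_gap_flat_allLevels (n := n) hL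
  obtain ⟨ε₂, hε₂, H₂⟩ := effectiveForm_le_mass_flat_allLevels (n := n) hL
  refine ⟨min ε₁ ε₂, lt_min hε₁ hε₂, fun ε hε hεle N _ hN j v hdiv hmean => ⟨?_, ?_⟩⟩
  · exact H₁ ε hε (hεle.trans (min_le_left _ _)) N hN j v hdiv hmean
  · exact H₂ ε hε (hεle.trans (min_le_right _ _)) N hN j v

end

end Summit.QuantumFields.BalabanUV.T4Continuum.NE7EffectiveFormUpperBound
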